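import Summits.CriticalPhenomena.SAWScalingLimit.Theses.SAWSpinMonotone
import Summits.CriticalPhenomena.SAWScalingLimit.Theorems.SAWSpinMonotoneArrivalFlatteningSpinChordDefs
import Summits.CriticalPhenomena.SAWScalingLimit.Theorems.NoFoldBound.Negative.SingletonTightness
import Summits.CriticalPhenomena.SAWScalingLimit.Theorems.SAWDefectDecoherenceDefectDecoherenceTmExterior
import Literature.Probability.RandomPlanarGeometry.HexDomainSingleton
import Literature.Probability.RandomPlanarGeometry.HexParafermionSpinShift

/-!
# The 4-vertex ball witness for the crux `ArrivalFlattening` (route SAWSpinMonotone, stmt-CriticalPhenomena-16770)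

Negative-side (cdisprove) support file. The smallest punctured configuration of the crux
`Summit.CriticalPhenomena.SAWScalingLimit.Theses.SAWSpinMonotone.ArrivalFlattening`: the domain
`Λ₄ = {V0, U0, N1, N2}` (the up-face `V0 = (0;0)` and its three neighbours, coordinates of
`NoFoldBound/Negative/SingletonTightness`), root `a = {E0, U0}` (`E0 = (e₀;0) ∉ Λ₄`), punctured at `v = V0`.

* `erase_V0`: `Λ₄ ∖ V0 = D₃ = {U0, N1, N2}`, an independent set (`not_adj_of_mem_D₃`), so every walk of `D₃` from the
  root is the one-step walk `[U0]` (`verts_eq_U0`): the port `{V0,U0}` carries exactly `[U0]` (`norm_obs_port_U0`), the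
  ports `{V0,N1}`, `{V0,N2}` carry nothing (`obs_port_other`), and **`‖arrivalTransform Λ₄ a V0 U0 N1 N2 s‖ = x_c` for
  every spin `s`** (`norm_arrivalTransform_Λ₄`) — the first-arrival ratio of the crux is `1` here.
* `mem_Λ₄_iff`: `Λ₄` is the closed Euclidean ball `B(c(V0), 1/√3)` of lattice vertices (nine times the squared distance is
  the integer form `P² + PQ + Q²`, `P = 3x₀ + i`, `Q = 3x₁ + i`, `nine_mul_normSq`; its values `≤ 8` occur only on `Λ₄`,
  `mem_Λ₄_of_form_le`); `mem_Λ₄_of_dist_lt_one`: no vertex lies at distance in `(1/√3, 1)`; `Λ₄_simplyConnected`: the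
  complement is the exterior of a Euclidean ball, preconnected by `exterior_preconnected`
  (`…Theorems.SAWDefectDecoherenceDefectDecoherenceTmExterior`).

Used by `Negative/DepthLoadBearing.lean` (depth is load-bearing, `R(ε) ≥ 1`, portwise vanishing fails). Sources:
H. Duminil-Copin, S. Smirnov, Ann. of Math. 175 (2012), §1–2 (walks between mid-edges, domains with connected
complement). Sorry-free; axioms `propext`, `Classical.choice`, `Quot.sound`.
-/


noncomputable section

open Literature.Probability.LatticeModels Literature.Probability.RandomPlanarGeometry.SAW
open Summit.CriticalPhenomena.SAWScalingLimit.Theses.SAWSpinMonotone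
open Summit.CriticalPhenomena.SAWScalingLimit.Cruxes.ArrivalFlattening.SpinChord
open Summit.CriticalPhenomena.SAWScalingLimit.Theorems
open Summit.CriticalPhenomena.SAWScalingLimit.Theorems.DefectDecoherence.TipMartingale
  (dist_sq_eq_normSq exterior_preconnected)
open scoped ComplexConjugate

namespace Summit.CriticalPhenomena.SAWScalingLimit.Theorems.ArrivalFlattening.Negative

/-! ## §1 The depth hypothesis is load-bearing: the 4-vertex ball -/

/-- `U0 ~ E0`. -/
theorem adj_U0_E0 : hexGraph.Adj (((0 : Site 2)), (1 : Fin 2)) (((Pi.single 0 1 : Site 2)), (0 : Fin 2)) := by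
  rw [hexGraph.adj_comm, hexGraph_adj_iff_coord]; simp
/-- `E0 ≠ V0`. -/
theorem E0_ne_V0 : (((Pi.single 0 1 : Site 2)), (0 : Fin 2)) ≠ (((0 : Site 2)), (0 : Fin 2)) := by
  intro h; have := congrArg (fun v : HexVertex => v.1 0) h; simp at this
/-- `E0 ≠ U0`. -/
theorem E0_ne_U0 : (((Pi.single 0 1 : Site 2)), (0 : Fin 2)) ≠ (((0 : Site 2)), (1 : Fin 2)) := by
  intro h; have := congrArg (fun v : HexVertex => v.2) h; simp at this
/-- `E0 ≠ N1`. -/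
theorem E0_ne_N1 : (((Pi.single 0 1 : Site 2)), (0 : Fin 2)) ≠ ((-(Pi.single 0 1 : Site 2)), (1 : Fin 2)) := by
  intro h; have := congrArg (fun v : HexVertex => v.2) h; simp at this
/-- `E0 ≠ N2`. -/
theorem E0_ne_N2 : (((Pi.single 0 1 : Site 2)), (0 : Fin 2)) ≠ ((-(Pi.single 1 1 : Site 2)), (1 : Fin 2)) := by
  intro h; have := congrArg (fun v : HexVertex => v.2) h; simp at this
/-- `V0 ≠ N1`. -/
theorem V0_ne_N1 : (((0 : Site 2)), (0 : Fin 2)) ≠ ((-(Pi.single 0 1 : Site 2)), (1 : Fin 2)) := by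
  intro h; have := congrArg (fun v : HexVertex => v.2) h; simp at this
/-- `V0 ≠ N2`. -/
theorem V0_ne_N2 : (((0 : Site 2)), (0 : Fin 2)) ≠ ((-(Pi.single 1 1 : Site 2)), (1 : Fin 2)) := by
  intro h; have := congrArg (fun v : HexVertex => v.2) h; simp at this

/-- `V0 ∉ D₃`. -/
theorem V0_notMem_D₃ : (((0 : Site 2)), (0 : Fin 2)) ∉ ({(((0 : Site 2)), (1 : Fin 2)), ((-(Pi.single 0 1 : Site 2)), (1 : Fin 2)), ((-(Pi.single 1 1 : Site 2)), (1 : Fin 2))} : Finset HexVertex) := by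
  simp only [Finset.mem_insert, Finset.mem_singleton, not_or]
  exact ⟨nfb_U0_ne_V0.symm, V0_ne_N1, V0_ne_N2⟩

/-- `Λ₄ ∖ V0 = D₃`. -/
theorem erase_V0 : (({(((0 : Site 2)), (0 : Fin 2)), (((0 : Site 2)), (1 : Fin 2)), ((-(Pi.single 0 1 : Site 2)), (1 : Fin 2)), ((-(Pi.single 1 1 : Site 2)), (1 : Fin 2))} : Finset HexVertex)).erase (((0 : Site 2)), (0 : Fin 2)) = ({(((0 : Site 2)), (1 : Fin 2)), ((-(Pi.single 0 1 : Site 2)), (1 : Fin 2)), ((-(Pi.single 1 1 : Site 2)), (1 : Fin 2))} : Finset HexVertex) :=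
  Finset.erase_insert V0_notMem_D₃

/-- `E0 ∉ Λ₄`. -/
theorem E0_notMem_Λ₄ : (((Pi.single 0 1 : Site 2)), (0 : Fin 2)) ∉ ({(((0 : Site 2)), (0 : Fin 2)), (((0 : Site 2)), (1 : Fin 2)), ((-(Pi.single 0 1 : Site 2)), (1 : Fin 2)), ((-(Pi.single 1 1 : Site 2)), (1 : Fin 2))} : Finset HexVertex) := by
  simp only [Finset.mem_insert, Finset.mem_singleton, not_or]
  exact ⟨E0_ne_V0, E0_ne_U0, E0_ne_N1, E0_ne_N2⟩

/-- `E0 ∉ D₃`. -/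
theorem E0_notMem_D₃ : (((Pi.single 0 1 : Site 2)), (0 : Fin 2)) ∉ ({(((0 : Site 2)), (1 : Fin 2)), ((-(Pi.single 0 1 : Site 2)), (1 : Fin 2)), ((-(Pi.single 1 1 : Site 2)), (1 : Fin 2))} : Finset HexVertex) := by
  simp only [Finset.mem_insert, Finset.mem_singleton, not_or]
  exact ⟨E0_ne_U0, E0_ne_N1, E0_ne_N2⟩

/-- The root `a = {E0, U0}` is a boundary mid-edge of `Λ₄`. -/
theorem root_mem_boundary : s((((Pi.single 0 1 : Site 2)), (0 : Fin 2)), (((0 : Site 2)), (1 : Fin 2))) ∈ hexDomainBoundary ({(((0 : Site 2)), (0 : Fin 2)), (((0 : Site 2)), (1 : Fin 2)), ((-(Pi.single 0 1 : Site 2)), (1 : Fin 2)), ((-(Pi.single 1 1 : Site 2)), (1 : Fin 2))} : Finset HexVertex) :=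
  ⟨(SimpleGraph.mem_edgeSet hexGraph).2 adj_U0_E0.symm, (((Pi.single 0 1 : Site 2)), (0 : Fin 2)), _, rfl, by simp, E0_notMem_Λ₄⟩

/-- `D₃` is an independent set: its three vertices are down-faces. -/
theorem not_adj_of_mem_D₃ {p q : HexVertex} (hp : p ∈ ({(((0 : Site 2)), (1 : Fin 2)), ((-(Pi.single 0 1 : Site 2)), (1 : Fin 2)), ((-(Pi.single 1 1 : Site 2)), (1 : Fin 2))} : Finset HexVertex)) (hq : q ∈ ({(((0 : Site 2)), (1 : Fin 2)), ((-(Pi.single 0 1 : Site 2)), (1 : Fin 2)), ((-(Pi.single 1 1 : Site 2)), (1 : Fin 2))} : Finset HexVertex)) : ¬ hexGraph.Adj p q := by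
  simp only [Finset.mem_insert, Finset.mem_singleton] at hp hq
  apply not_hexGraph_adj_of_snd_eq_holds
  rcases hp with rfl | rfl | rfl <;> rcases hq with rfl | rfl | rfl <;> rfl

/-- **Classification**: every walk of `D₃` from the root to a mid-edge `z ≠ a` is the one-step walk `[U0]`. -/
theorem verts_eq_U0 {z : Sym2 HexVertex} (hz : z ≠ s((((Pi.single 0 1 : Site 2)), (0 : Fin 2)), (((0 : Site 2)), (1 : Fin 2))))
    (γ : HexMidEdgeSAW ({(((0 : Site 2)), (1 : Fin 2)), ((-(Pi.single 0 1 : Site 2)), (1 : Fin 2)), ((-(Pi.single 1 1 : Site 2)), (1 : Fin 2))} : Finset HexVertex) s((((Pi.single 0 1 : Site 2)), (0 : Fin 2)), (((0 : Site 2)), (1 : Fin 2))) z) : γ.verts = [(((0 : Site 2)), (1 : Fin 2))] := by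
  rcases h : γ.verts with _ | ⟨p, l⟩
  · exact absurd (γ.eq_of_nil h).symm hz
  · have hp : p ∈ ({(((0 : Site 2)), (1 : Fin 2)), ((-(Pi.single 0 1 : Site 2)), (1 : Fin 2)), ((-(Pi.single 1 1 : Site 2)), (1 : Fin 2))} : Finset HexVertex) := γ.subset p (by simp [h])
    have hpa : p ∈ s((((Pi.single 0 1 : Site 2)), (0 : Fin 2)), (((0 : Site 2)), (1 : Fin 2))) := γ.head_mem p (by simp [h])
    have hpU : p = (((0 : Site 2)), (1 : Fin 2)) := by
      rcases Sym2.mem_iff.1 hpa with rfl | rfl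
      · exact absurd hp E0_notMem_D₃
      · rfl
    subst hpU
    rcases l with _ | ⟨q, l'⟩
    · rfl
    · exfalso
      have hq : q ∈ ({(((0 : Site 2)), (1 : Fin 2)), ((-(Pi.single 0 1 : Site 2)), (1 : Fin 2)), ((-(Pi.single 1 1 : Site 2)), (1 : Fin 2))} : Finset HexVertex) := γ.subset q (by simp [h])
      have hc := γ.isChain
      rw [h] at hc
      have hadj : hexGraph.Adj (((0 : Site 2)), (1 : Fin 2)) q := (List.isChain_cons_cons.1 hc).1
      exact not_adj_of_mem_D₃ (by simp) hq hadj

/-- **Port `U0` carries exactly the walk `[U0]`**, so `‖F_{D₃}(a, {V0,U0}; x, s)‖ = x` for every spin (`x ≥ 0`). -/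
theorem norm_obs_port_U0 {x : ℝ} (hx : 0 ≤ x) (s : ℝ) :
    ‖hexParafermionicObservable ({(((0 : Site 2)), (1 : Fin 2)), ((-(Pi.single 0 1 : Site 2)), (1 : Fin 2)), ((-(Pi.single 1 1 : Site 2)), (1 : Fin 2))} : Finset HexVertex) s((((Pi.single 0 1 : Site 2)), (0 : Fin 2)), (((0 : Site 2)), (1 : Fin 2))) x s s((((0 : Site 2)), (0 : Fin 2)), (((0 : Site 2)), (1 : Fin 2)))‖ = x := by
  have hz : s((((0 : Site 2)), (0 : Fin 2)), (((0 : Site 2)), (1 : Fin 2))) ≠ s((((Pi.single 0 1 : Site 2)), (0 : Fin 2)), (((0 : Site 2)), (1 : Fin 2))) := by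
    rw [Ne, Sym2.eq_iff]
    rintro (⟨h1, -⟩ | ⟨h1, -⟩)
    · exact E0_ne_V0 h1.symm
    · exact nfb_U0_ne_V0 h1.symm
  let γ₀ : HexMidEdgeSAW ({(((0 : Site 2)), (1 : Fin 2)), ((-(Pi.single 0 1 : Site 2)), (1 : Fin 2)), ((-(Pi.single 1 1 : Site 2)), (1 : Fin 2))} : Finset HexVertex) s((((Pi.single 0 1 : Site 2)), (0 : Fin 2)), (((0 : Site 2)), (1 : Fin 2))) s((((0 : Site 2)), (0 : Fin 2)), (((0 : Site 2)), (1 : Fin 2))) :=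
    { verts := [(((0 : Site 2)), (1 : Fin 2))]
      subset := by simp
      nodup := List.nodup_singleton _
      isChain := List.IsChain.singleton _
      head_mem := by simp
      getLast_mem := by simp
      eq_of_nil := by simp
      edges_nodup := fun _ => by simp [hz.symm]
      fst_mem := ⟨(SimpleGraph.mem_edgeSet hexGraph).2 adj_U0_E0.symm, _, Sym2.mem_mk_right _ _, by simp⟩ }
  letI : Unique (HexMidEdgeSAW ({(((0 : Site 2)), (1 : Fin 2)), ((-(Pi.single 0 1 : Site 2)), (1 : Fin 2)), ((-(Pi.single 1 1 : Site 2)), (1 : Fin 2))} : Finset HexVertex) s((((Pi.single 0 1 : Site 2)), (0 : Fin 2)), (((0 : Site 2)), (1 : Fin 2))) s((((0 : Site 2)), (0 : Fin 2)), (((0 : Site 2)), (1 : Fin 2)))) :=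
    ⟨⟨γ₀⟩, fun γ => HexMidEdgeSAW.ext (by rw [verts_eq_U0 hz γ]; rfl)⟩
  rw [hexParafermionicObservable, Fintype.sum_unique]
  show ‖γ₀.weight x s‖ = x
  rw [HexMidEdgeSAW.norm_weight _ hx]
  simp [HexMidEdgeSAW.length, γ₀]

/-- **The two other ports carry no walk**: `F_{D₃}(a, {V0, n}; x, s) = 0` for `n ∈ {N1, N2}` (the last vertex
of `[U0]` is not on `{V0, n}`). -/
theorem obs_port_other {n : HexVertex} (hnV : n ≠ (((0 : Site 2)), (1 : Fin 2))) (hnE : n ≠ (((Pi.single 0 1 : Site 2)), (0 : Fin 2))) (x s : ℝ) :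
    hexParafermionicObservable ({(((0 : Site 2)), (1 : Fin 2)), ((-(Pi.single 0 1 : Site 2)), (1 : Fin 2)), ((-(Pi.single 1 1 : Site 2)), (1 : Fin 2))} : Finset HexVertex) s((((Pi.single 0 1 : Site 2)), (0 : Fin 2)), (((0 : Site 2)), (1 : Fin 2))) x s s((((0 : Site 2)), (0 : Fin 2)), n) = 0 := by
  have hz : s((((0 : Site 2)), (0 : Fin 2)), n) ≠ s((((Pi.single 0 1 : Site 2)), (0 : Fin 2)), (((0 : Site 2)), (1 : Fin 2))) := by
    rw [Ne, Sym2.eq_iff]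
    rintro (⟨h1, -⟩ | ⟨-, h2⟩)
    · exact E0_ne_V0 h1.symm
    · exact hnE h2
  haveI : IsEmpty (HexMidEdgeSAW ({(((0 : Site 2)), (1 : Fin 2)), ((-(Pi.single 0 1 : Site 2)), (1 : Fin 2)), ((-(Pi.single 1 1 : Site 2)), (1 : Fin 2))} : Finset HexVertex) s((((Pi.single 0 1 : Site 2)), (0 : Fin 2)), (((0 : Site 2)), (1 : Fin 2))) s((((0 : Site 2)), (0 : Fin 2)), n)) := by
    refine ⟨fun γ => ?_⟩
    have hv := verts_eq_U0 hz γ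
    have hl := γ.getLast_mem (((0 : Site 2)), (1 : Fin 2)) (by rw [hv]; rfl)
    rcases Sym2.mem_iff.1 hl with h | h
    · exact nfb_U0_ne_V0 h
    · exact hnV h.symm
  simp [hexParafermionicObservable]

/-- **The first-arrival transform of the witness is one unimodular term**: `‖A(s)‖ = x_c` for every spin `s`. -/
theorem norm_arrivalTransform_Λ₄ (s : ℝ) :
    ‖arrivalTransform ({(((0 : Site 2)), (0 : Fin 2)), (((0 : Site 2)), (1 : Fin 2)), ((-(Pi.single 0 1 : Site 2)), (1 : Fin 2)), ((-(Pi.single 1 1 : Site 2)), (1 : Fin 2))} : Finset HexVertex) s((((Pi.single 0 1 : Site 2)), (0 : Fin 2)), (((0 : Site 2)), (1 : Fin 2))) (((0 : Site 2)), (0 : Fin 2)) (((0 : Site 2)), (1 : Fin 2)) ((-(Pi.single 0 1 : Site 2)), (1 : Fin 2)) ((-(Pi.single 1 1 : Site 2)), (1 : Fin 2)) s‖ = hexCriticalFugacity := by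
  rw [arrivalTransform, erase_V0, obs_port_other nfb_U0_ne_N1.symm E0_ne_N1.symm,
    obs_port_other nfb_U0_ne_N2.symm E0_ne_N2.symm, add_zero, add_zero,
    norm_obs_port_U0 hexCriticalFugacity_pos_lt_one.1.le]

/-! ### The 4-ball is a Euclidean ball, hence simply connected -/

/-- Nine times the squared distance from `c(V0)` is the integer form `P² + PQ + Q²`, `P = 3x₀ + i`, `Q = 3x₁ + i`. -/
theorem nine_mul_normSq (x : Site 2) (i : Fin 2) :
    9 * Complex.normSq (hexCenter (x, i) - hexCenter (((0 : Site 2)), (0 : Fin 2))) =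
      (((3 * x 0 + (i : ℕ)) ^ 2 + (3 * x 0 + (i : ℕ)) * (3 * x 1 + (i : ℕ)) + (3 * x 1 + (i : ℕ)) ^ 2 : ℤ) : ℝ) := by
  rw [hexCenter_sub_hexCenter, normSq_add_mul_triZeta]
  push_cast
  simp only [Pi.zero_apply, Int.cast_zero, sub_zero, CharP.cast_eq_zero]
  ring

/-- The integer form takes no value in `(3, 9)` on the two cosets, and its values `≤ 3` are attained exactly on
`Λ₄`: `P² + PQ + Q² ≤ 8` (`P = 3x₀+i`, `Q = 3x₁+i`) forces `(x, i) ∈ Λ₄`. -/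
theorem mem_Λ₄_of_form_le (x : Site 2) (i : Fin 2)
    (h : (3 * x 0 + (i : ℕ)) ^ 2 + (3 * x 0 + (i : ℕ)) * (3 * x 1 + (i : ℕ)) + (3 * x 1 + (i : ℕ)) ^ 2 ≤ (8 : ℤ)) :
    (x, i) ∈ ({(((0 : Site 2)), (0 : Fin 2)), (((0 : Site 2)), (1 : Fin 2)), ((-(Pi.single 0 1 : Site 2)), (1 : Fin 2)), ((-(Pi.single 1 1 : Site 2)), (1 : Fin 2))} : Finset HexVertex) := by
  have hmem : ∀ (y : Site 2) (j : Fin 2), x 0 = y 0 → x 1 = y 1 → i = j → (x, i) = (y, j) := by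
    intro y j h0 h1 hij
    refine Prod.ext (funext fun k => ?_) hij
    fin_cases k
    · exact h0
    · exact h1
  have hi : ((i : ℕ) : ℤ) = 0 ∨ ((i : ℕ) : ℤ) = 1 := by
    rcases Fin.exists_fin_two.1 ⟨i, rfl⟩ with h | h <;> simp [h]
  -- `4(P² + PQ + Q²) = (P + 2Q)² + 3P²`, so `P² ≤ 32/3`, `|P| ≤ 3`; same for `Q`
  have hP : -3 ≤ 3 * x 0 + ((i : ℕ) : ℤ) ∧ 3 * x 0 + ((i : ℕ) : ℤ) ≤ 3 := by
    constructor <;> nlinarith [sq_nonneg (3 * x 0 + ((i : ℕ) : ℤ) + 2 * (3 * x 1 + ((i : ℕ) : ℤ)))]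
  have hQ : -3 ≤ 3 * x 1 + ((i : ℕ) : ℤ) ∧ 3 * x 1 + ((i : ℕ) : ℤ) ≤ 3 := by
    constructor <;> nlinarith [sq_nonneg (3 * x 1 + ((i : ℕ) : ℤ) + 2 * (3 * x 0 + ((i : ℕ) : ℤ)))]
  have hx0 : x 0 = -1 ∨ x 0 = 0 ∨ x 0 = 1 := by omega
  have hx1 : x 1 = -1 ∨ x 1 = 0 ∨ x 1 = 1 := by omega
  simp only [Finset.mem_insert, Finset.mem_singleton]
  rcases hi with hi | hi
  · have hi0 : i = 0 := Fin.ext (by rw [Fin.val_zero]; exact_mod_cast hi)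
    subst hi0
    rw [hi] at h
    rcases hx0 with h0 | h0 | h0 <;> rcases hx1 with h1 | h1 | h1 <;> rw [h0, h1] at h <;> norm_num at h
    exact Or.inl (hmem 0 0 (by simp [h0]) (by simp [h1]) rfl)
  · have hi1 : i = 1 := Fin.ext (by rw [Fin.val_one]; exact_mod_cast hi)
    subst hi1
    rw [hi] at h
    rcases hx0 with h0 | h0 | h0 <;> rcases hx1 with h1 | h1 | h1 <;> rw [h0, h1] at h <;> norm_num at h
    · exact Or.inr (Or.inr (Or.inl (hmem _ 1 (by simp [h0]) (by simp [h1]) rfl)))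
    · exact Or.inr (Or.inr (Or.inr (hmem _ 1 (by simp [h0]) (by simp [h1]) rfl)))
    · exact Or.inr (Or.inl (hmem 0 1 (by simp [h0]) (by simp [h1]) rfl))

/-- On `Λ₄` the form is `≤ 3` (values `0, 3, 3, 3`). -/
theorem form_le_of_mem_Λ₄ {x : Site 2} {i : Fin 2} (h : (x, i) ∈ ({(((0 : Site 2)), (0 : Fin 2)), (((0 : Site 2)), (1 : Fin 2)), ((-(Pi.single 0 1 : Site 2)), (1 : Fin 2)), ((-(Pi.single 1 1 : Site 2)), (1 : Fin 2))} : Finset HexVertex)) :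
    (3 * x 0 + (i : ℕ)) ^ 2 + (3 * x 0 + (i : ℕ)) * (3 * x 1 + (i : ℕ)) + (3 * x 1 + (i : ℕ)) ^ 2 ≤ (3 : ℤ) := by
  simp only [Finset.mem_insert, Finset.mem_singleton, Prod.mk.injEq] at h
  rcases h with ⟨rfl, rfl⟩ | ⟨rfl, rfl⟩ | ⟨rfl, rfl⟩ | ⟨rfl, rfl⟩ <;> simp

/-- **`Λ₄` is the closed Euclidean ball of radius `1/√3` about `c(V0)`.** -/
theorem mem_Λ₄_iff (w : HexVertex) :
    w ∈ ({(((0 : Site 2)), (0 : Fin 2)), (((0 : Site 2)), (1 : Fin 2)), ((-(Pi.single 0 1 : Site 2)), (1 : Fin 2)), ((-(Pi.single 1 1 : Site 2)), (1 : Fin 2))} : Finset HexVertex) ↔ dist (hexCenter w) (hexCenter (((0 : Site 2)), (0 : Fin 2))) ≤ (Real.sqrt 3)⁻¹ := by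
  obtain ⟨x, i⟩ := w
  have hd : 0 ≤ dist (hexCenter (x, i)) (hexCenter (((0 : Site 2)), (0 : Fin 2))) := dist_nonneg
  have h3 : (0 : ℝ) < (Real.sqrt 3)⁻¹ := by positivity
  have hsq : ((Real.sqrt 3)⁻¹) ^ 2 = 3⁻¹ := by rw [inv_pow, Real.sq_sqrt (by norm_num : (0 : ℝ) ≤ 3)]
  have key : dist (hexCenter (x, i)) (hexCenter (((0 : Site 2)), (0 : Fin 2))) ≤ (Real.sqrt 3)⁻¹ ↔
      9 * Complex.normSq (hexCenter (x, i) - hexCenter (((0 : Site 2)), (0 : Fin 2))) ≤ 3 := by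
    rw [← abs_of_nonneg hd, ← abs_of_nonneg h3.le, ← sq_le_sq, dist_sq_eq_normSq, hsq]
    constructor <;> intro h <;> nlinarith
  rw [key, nine_mul_normSq]
  constructor
  · intro h; exact_mod_cast form_le_of_mem_Λ₄ h
  · intro h
    have h' : (3 * x 0 + (i : ℕ)) ^ 2 + (3 * x 0 + (i : ℕ)) * (3 * x 1 + (i : ℕ)) + (3 * x 1 + (i : ℕ)) ^ 2 ≤ (3 : ℤ) := by
      exact_mod_cast h
    exact mem_Λ₄_of_form_le x i (by omega)

/-- **Nothing between the first two shells**: a vertex at distance `< 1` from `c(V0)` lies in `Λ₄` (the form has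
no value in `(3, 9)`), so the witness configuration is `R`-deep for every `R < 1`. -/
theorem mem_Λ₄_of_dist_lt_one {w : HexVertex}
    (h : dist (hexCenter w) (hexCenter (((0 : Site 2)), (0 : Fin 2))) < 1) : w ∈ ({(((0 : Site 2)), (0 : Fin 2)), (((0 : Site 2)), (1 : Fin 2)), ((-(Pi.single 0 1 : Site 2)), (1 : Fin 2)), ((-(Pi.single 1 1 : Site 2)), (1 : Fin 2))} : Finset HexVertex) := by
  obtain ⟨x, i⟩ := w
  have hd : 0 ≤ dist (hexCenter (x, i)) (hexCenter (((0 : Site 2)), (0 : Fin 2))) := dist_nonneg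
  have h9 : 9 * Complex.normSq (hexCenter (x, i) - hexCenter (((0 : Site 2)), (0 : Fin 2))) < 9 := by
    rw [← dist_sq_eq_normSq]; nlinarith
  rw [nine_mul_normSq] at h9
  have h' : (3 * x 0 + (i : ℕ)) ^ 2 + (3 * x 0 + (i : ℕ)) * (3 * x 1 + (i : ℕ)) + (3 * x 1 + (i : ℕ)) ^ 2 < (9 : ℤ) := by
    exact_mod_cast h9
  exact mem_Λ₄_of_form_le x i (by omega)

/-- **`Λ₄` is simply connected**: its complement is the exterior `{w | 1/√3 < dist}` of a Euclidean ball,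
preconnected by `exterior_preconnected`. -/
theorem Λ₄_simplyConnected : hexDomainSimplyConnected ({(((0 : Site 2)), (0 : Fin 2)), (((0 : Site 2)), (1 : Fin 2)), ((-(Pi.single 0 1 : Site 2)), (1 : Fin 2)), ((-(Pi.single 1 1 : Site 2)), (1 : Fin 2))} : Finset HexVertex) := by
  unfold hexDomainSimplyConnected
  have hset : ((↑({(((0 : Site 2)), (0 : Fin 2)), (((0 : Site 2)), (1 : Fin 2)), ((-(Pi.single 0 1 : Site 2)), (1 : Fin 2)), ((-(Pi.single 1 1 : Site 2)), (1 : Fin 2))} : Finset HexVertex) : Set HexVertex)ᶜ) =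
      {w : HexVertex | (Real.sqrt 3)⁻¹ < dist (hexCenter w) (hexCenter (((0 : Site 2)), (0 : Fin 2)))} := by
    ext w
    simp only [Set.mem_compl_iff, Finset.mem_coe, Set.mem_setOf_eq, mem_Λ₄_iff, not_le]
  rw [hset]
  exact exterior_preconnected _ _

end Summit.CriticalPhenomena.SAWScalingLimit.Theorems.ArrivalFlattening.Negative

end
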